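import Literature.Probability.LatticeModels.CircuitManeuverNcw
import Literature.Probability.LatticeModels.CircuitManeuverNccw
import Literature.Probability.LatticeModels.CircuitManeuverNEcw
import Literature.Probability.LatticeModels.CircuitManeuverNEccw
import Literature.Probability.Percolation.PlanarDuality
import Summits.CriticalPhenomena.SAWScalingLimit.Theorems.SAWLoopFugacityFlowAvoidanceLimitChainHit
import Summits.CriticalPhenomena.SAWScalingLimit.Theorems.SAWLoopFugacityFlowAvoidanceLimitHitComparison
import HarnessLib

/-!
# The lattice core of the shielding lemma (corrected Chelkak 2016, Lemma 2.14)

Sub-problem `CriticalPhenomena/SAWScalingLimit`, crux `AvoidanceLimit`, line `symplectic-fermion-anchor`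
(lead c5, §shield). Purely lattice statements, one per circuit design (`shieldCore_Ncw`,
`shieldCore_Nccw`, `shieldCore_NEcw`, `shieldCore_NEccw`): let `Gr` be any graph on `ℤ²` (the
edge-killed walk of a discrete domain), `Θ` a finite set of sites, `A` a target set (the vertices
of the superlevel walk `γ`) and `S ⊆ Θ ∩ mW c k` a set of "certified" sites, disjoint from `A`, at
which all four lattice edges are `Gr`-edges and whose lattice neighbours inside the box `mW c k`
lie in `S`, in `A`, in the slit wedge or in the germ box of the design. If some `A`-walk crosses
transversally one of the strips of the circuit, then from every point `x ∈ S` of the design's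
start box the walk on `Gr` killed outside `Θ` hits `A` with probability at least the circuit
constant: the free chain is bounded below (`circ…Const_le_chainM`), the chain killed on `Sᶜ`
vanishes (its crossings in `S`, `circ…_crossings_of_chainN_pos`, would meet the `A`-crossing,
`Percolation.exists_mem_support_of_crossing`), their difference is at most the free
first-exit-into-`A` probability (`chainM_sub_chainN_le_harmExt_hit`), which is at most the killed
hitting probability (`harmExt_hit_le_hitProb`).
The `A`-crossings are supplied by the companion file `…ShieldCrossing.lean`.

## References

* D. Chelkak, Robust discrete complex analysis: a toolbox, Ann. Probab. 44 (2016), Lemma 2.12 and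
  Lemma 2.14 (proof, Appendix). [Chelkak2016]
-/

noncomputable section

open scoped BigOperators Classical
open Finset Literature.Probability.LatticeModels

namespace Summit.CriticalPhenomena.SAWScalingLimit.Theorems.AvoidanceLimit.Anchor

/-- **Shield core, design N-cw.** See the module docstring. [cite: Chelkak2016, Lemma 2.14] -/
theorem shieldCore_Ncw :
    ∀ (Gr : SimpleGraph (Site 2)) (Θ A S : Set (Site 2)) (c : Site 2) (k : ℕ), 5 ≤ k → Θ.Finite →
      Disjoint S A → S ⊆ Θ → S ⊆ mW c k →
      (∀ v ∈ S, ∀ e : SRW.Dir 2, Gr.Adj v (v + SRW.stepVec e)) →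
      (∀ v ∈ S, ∀ kk : Fin 4, v + cornerUnit kk ∈ mW c k →
        v + cornerUnit kk ∈ S ∨ v + cornerUnit kk ∈ A ∨
          (|(v + cornerUnit kk) 0 - c 0| ≤ 2 * k ∧ -11 * (k : ℤ) ≤ (v + cornerUnit kk) 1 - c 1 ∧
              (v + cornerUnit kk) 1 - c 1 ≤ -7 * k) ∨
          (-9 * (k : ℤ) - 1 ≤ (v + cornerUnit kk) 1 - c 1 ∧
              12 * |(v + cornerUnit kk) 0 - c 0| ≤ 5 * ((v + cornerUnit kk) 1 - c 1 + 9 * k) + 13)) →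
      ((∃ (u v : Site 2) (σ : (zdGraph 2).Walk u v), u 0 = c 0 + 12 * k ∧ v 0 = c 0 + 36 * k ∧
          ∀ z ∈ σ.support, z ∈ A ∧ c 0 + 12 * k ≤ z 0 ∧ z 0 ≤ c 0 + 36 * k ∧ c 1 - 36 * k ≤ z 1 ∧ z 1 ≤ c 1 + 17 * k) ∨
       (∃ (u v : Site 2) (σ : (zdGraph 2).Walk u v), u 1 = c 1 - 36 * k ∧ v 1 = c 1 - 12 * k ∧
          ∀ z ∈ σ.support, z ∈ A ∧ c 0 - 36 * k ≤ z 0 ∧ z 0 ≤ c 0 + 36 * k ∧ c 1 - 36 * k ≤ z 1 ∧ z 1 ≤ c 1 - 12 * k) ∨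
       (∃ (u v : Site 2) (σ : (zdGraph 2).Walk u v), u 0 = c 0 - 36 * k ∧ v 0 = c 0 - 12 * k ∧
          ∀ z ∈ σ.support, z ∈ A ∧ c 0 - 36 * k ≤ z 0 ∧ z 0 ≤ c 0 - 12 * k ∧ c 1 - 36 * k ≤ z 1 ∧ z 1 ≤ c 1 + 17 * k)) →
      ∀ x ∈ S, 20 * (k : ℤ) ≤ x 0 - c 0 → x 0 - c 0 ≤ 28 * k → 17 * (k : ℤ) ≤ x 1 - c 1 → x 1 - c 1 ≤ 18 * k →
        circNcwConst ≤ hitProb Gr Θ A x := by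
  intro Gr Θ A S c k hk hΘ hSA hSΘ hSW hadj hcl hA x hxS hx0 hx0' hx1 hx1'
  have hk0 : 0 < k := by omega
  set W := mW c k with hW
  have hWfin : W.Finite := mW_finite c k
  set F : Site 2 → ℝ := harmExt (S ∩ W) (fun w => if w ∈ A then (1 : ℝ) else 0) with hF
  -- the start point lies in the first start set
  have hxT : x ∈ circNcwT c k 0 := circNcw_start c k hk0 x hx0 hx0' (by omega) hx1'
  -- (III-A): the refined chain inequality
  have hkey : ∀ i, ∀ v ∈ circNcwU c k i ∩ S, ∀ kk : Fin 4,
      v + cornerUnit kk ∈ S ∨ v + cornerUnit kk ∈ A ∨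
        (v + cornerUnit kk ∉ circNcwU c k i ∧ v + cornerUnit kk ∉ circNcwL c k i) := by
    intro i v hv kk
    by_cases hw : v + cornerUnit kk ∈ circNcwU c k i ∪ circNcwL c k i
    · have hwW : v + cornerUnit kk ∈ mW c k := by
        rcases hw with h | h
        · exact circNcwU_subset_mW c k i h
        · exact circNcwL_subset_mW c k hk0 i h
      rcases hcl v hv.2 kk hwW with h | h | h | h
      · exact Or.inl h
      · exact Or.inr (Or.inl h)
      · exfalso
        have hav := (circNcw_avoids c k hk i _ hw).1
        rcases hav with h' | h' | h' <;> omega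
      · exfalso
        have hav := (circNcw_avoids c k hk i _ hw).2
        rcases hav with h' | h' <;> omega
    · rw [Set.mem_union, not_or] at hw
      exact Or.inr (Or.inr hw)
  have hIII := chainM_sub_chainN_le_harmExt_hit (circNcwU c k) (circNcwL c k) S A W 7 (circNcwU_finite c k) hWfin
    (circNcwU_subset_mW c k) (circNcwL_subset_mW c k hk0) (disjoint_circNcwU_L c k) hSA hkey 7 x hxS
  -- (II): the free chain
  have hII := circNcwConst_le_chainM c k hk0 x hxT
  -- (I-A): the killed chain vanishes
  have hI : chainN (circNcwU c k) (circNcwL c k) S 7 7 x = 0 := by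
    by_contra hne
    have hpos : 0 < chainN (circNcwU c k) (circNcwL c k) S 7 7 x :=
      lt_of_le_of_ne (chainN_mem_Icc (circNcwU_finite c k) 7 x).1 (Ne.symm hne)
    obtain ⟨hR, hB, hL⟩ := circNcw_crossings_of_chainN_pos c k hk0 x hxT hxS (by omega) hpos
    have disj : ∀ z, z ∈ S → z ∈ A → False := fun z hzS hzA => hSA.le_bot ⟨hzS, hzA⟩
    rcases hA with ⟨u, v, σ, hu, hv, hσ⟩ | ⟨u, v, σ, hu, hv, hσ⟩ | ⟨u, v, σ, hu, hv, hσ⟩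
    · -- right strip: `σ` left → right in `A`, the `S`-crossing bottom → top
      obtain ⟨u', v', τ, hu', hv', hτ⟩ := hR
      obtain ⟨z, hzσ, hzτ⟩ := Literature.Probability.Percolation.exists_mem_support_of_crossing
        (L := c 0 + 12 * k) (R := c 0 + 36 * k) (B := c 1 - 36 * k) (T := c 1 + 17 * k) σ τ
        (fun z hz => (hσ z hz).2) (fun z hz => (hτ z hz).2) hu hv hu' hv'
      exact disj z (hτ z hzτ).1 (hσ z hzσ).1
    · -- bottom strip: the `S`-crossing left → right, `σ` bottom → top in `A`
      obtain ⟨u', v', τ, hu', hv', hτ⟩ := hB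
      obtain ⟨z, hzτ, hzσ⟩ := Literature.Probability.Percolation.exists_mem_support_of_crossing
        (L := c 0 - 36 * k) (R := c 0 + 36 * k) (B := c 1 - 36 * k) (T := c 1 - 12 * k) τ σ
        (fun z hz => (hτ z hz).2) (fun z hz => (hσ z hz).2) hu' hv' hu hv
      exact disj z (hτ z hzτ).1 (hσ z hzσ).1
    · -- left strip: `σ` left → right in `A`, the `S`-crossing bottom → top
      obtain ⟨u', v', τ, hu', hv', hτ⟩ := hL
      obtain ⟨z, hzσ, hzτ⟩ := Literature.Probability.Percolation.exists_mem_support_of_crossing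
        (L := c 0 - 36 * k) (R := c 0 - 12 * k) (B := c 1 - 36 * k) (T := c 1 + 17 * k) σ τ
        (fun z hz => (hσ z hz).2) (fun z hz => (hτ z hz).2) hu hv hu' hv'
      exact disj z (hτ z hzτ).1 (hσ z hzσ).1
  -- (IV): comparison with the killed hitting probability
  have hIV := harmExt_hit_le_hitProb Gr S A Θ W hΘ hWfin hSΘ hSW hSA hadj x
  rw [hI, sub_zero] at hIII
  calc circNcwConst ≤ chainM (circNcwU c k) (circNcwL c k) 7 7 x := hII
    _ ≤ F x := hIII
    _ ≤ hitProb Gr Θ A x := hIV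

/-- **Shield core, design N-ccw.** See the module docstring. [cite: Chelkak2016, Lemma 2.14] -/
theorem shieldCore_Nccw :
    ∀ (Gr : SimpleGraph (Site 2)) (Θ A S : Set (Site 2)) (c : Site 2) (k : ℕ), 5 ≤ k → Θ.Finite →
      Disjoint S A → S ⊆ Θ → S ⊆ mW c k →
      (∀ v ∈ S, ∀ e : SRW.Dir 2, Gr.Adj v (v + SRW.stepVec e)) →
      (∀ v ∈ S, ∀ kk : Fin 4, v + cornerUnit kk ∈ mW c k →
        v + cornerUnit kk ∈ S ∨ v + cornerUnit kk ∈ A ∨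
          (|(v + cornerUnit kk) 0 - c 0| ≤ 2 * k ∧ -11 * (k : ℤ) ≤ (v + cornerUnit kk) 1 - c 1 ∧
              (v + cornerUnit kk) 1 - c 1 ≤ -7 * k) ∨
          (-9 * (k : ℤ) - 1 ≤ (v + cornerUnit kk) 1 - c 1 ∧
              12 * |(v + cornerUnit kk) 0 - c 0| ≤ 5 * ((v + cornerUnit kk) 1 - c 1 + 9 * k) + 13)) →
      ((∃ (u v : Site 2) (σ : (zdGraph 2).Walk u v), u 0 = c 0 + 12 * k ∧ v 0 = c 0 + 36 * k ∧
          ∀ z ∈ σ.support, z ∈ A ∧ c 0 + 12 * k ≤ z 0 ∧ z 0 ≤ c 0 + 36 * k ∧ c 1 - 36 * k ≤ z 1 ∧ z 1 ≤ c 1 + 17 * k) ∨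
       (∃ (u v : Site 2) (σ : (zdGraph 2).Walk u v), u 1 = c 1 - 36 * k ∧ v 1 = c 1 - 12 * k ∧
          ∀ z ∈ σ.support, z ∈ A ∧ c 0 - 36 * k ≤ z 0 ∧ z 0 ≤ c 0 + 36 * k ∧ c 1 - 36 * k ≤ z 1 ∧ z 1 ≤ c 1 - 12 * k) ∨
       (∃ (u v : Site 2) (σ : (zdGraph 2).Walk u v), u 0 = c 0 - 36 * k ∧ v 0 = c 0 - 12 * k ∧
          ∀ z ∈ σ.support, z ∈ A ∧ c 0 - 36 * k ≤ z 0 ∧ z 0 ≤ c 0 - 12 * k ∧ c 1 - 36 * k ≤ z 1 ∧ z 1 ≤ c 1 + 17 * k)) →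
      ∀ x ∈ S, -28 * (k : ℤ) ≤ x 0 - c 0 → x 0 - c 0 ≤ -20 * k → 17 * (k : ℤ) ≤ x 1 - c 1 → x 1 - c 1 ≤ 18 * k →
        circNccwConst ≤ hitProb Gr Θ A x := by
  intro Gr Θ A S c k hk hΘ hSA hSΘ hSW hadj hcl hA x hxS hx0 hx0' hx1 hx1'
  have hk0 : 0 < k := by omega
  set W := mW c k with hW
  have hWfin : W.Finite := mW_finite c k
  set F : Site 2 → ℝ := harmExt (S ∩ W) (fun w => if w ∈ A then (1 : ℝ) else 0) with hF
  -- the start point lies in the first start set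
  have hxT : x ∈ circNccwT c k 0 := circNccw_start c k hk0 x hx0 hx0' (by omega) hx1'
  -- (III-A): the refined chain inequality
  have hkey : ∀ i, ∀ v ∈ circNccwU c k i ∩ S, ∀ kk : Fin 4,
      v + cornerUnit kk ∈ S ∨ v + cornerUnit kk ∈ A ∨
        (v + cornerUnit kk ∉ circNccwU c k i ∧ v + cornerUnit kk ∉ circNccwL c k i) := by
    intro i v hv kk
    by_cases hw : v + cornerUnit kk ∈ circNccwU c k i ∪ circNccwL c k i
    · have hwW : v + cornerUnit kk ∈ mW c k := by
        rcases hw with h | h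
        · exact circNccwU_subset_mW c k i h
        · exact circNccwL_subset_mW c k hk0 i h
      rcases hcl v hv.2 kk hwW with h | h | h | h
      · exact Or.inl h
      · exact Or.inr (Or.inl h)
      · exfalso
        have hav := (circNccw_avoids c k hk i _ hw).1
        rcases hav with h' | h' | h' <;> omega
      · exfalso
        have hav := (circNccw_avoids c k hk i _ hw).2
        rcases hav with h' | h' <;> omega
    · rw [Set.mem_union, not_or] at hw
      exact Or.inr (Or.inr hw)
  have hIII := chainM_sub_chainN_le_harmExt_hit (circNccwU c k) (circNccwL c k) S A W 7 (circNccwU_finite c k) hWfin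
    (circNccwU_subset_mW c k) (circNccwL_subset_mW c k hk0) (disjoint_circNccwU_L c k) hSA hkey 7 x hxS
  -- (II): the free chain
  have hII := circNccwConst_le_chainM c k hk0 x hxT
  -- (I-A): the killed chain vanishes
  have hI : chainN (circNccwU c k) (circNccwL c k) S 7 7 x = 0 := by
    by_contra hne
    have hpos : 0 < chainN (circNccwU c k) (circNccwL c k) S 7 7 x :=
      lt_of_le_of_ne (chainN_mem_Icc (circNccwU_finite c k) 7 x).1 (Ne.symm hne)
    obtain ⟨hL, hB, hR⟩ := circNccw_crossings_of_chainN_pos c k hk0 x hxT hxS (by omega) hpos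
    have disj : ∀ z, z ∈ S → z ∈ A → False := fun z hzS hzA => hSA.le_bot ⟨hzS, hzA⟩
    rcases hA with ⟨u, v, σ, hu, hv, hσ⟩ | ⟨u, v, σ, hu, hv, hσ⟩ | ⟨u, v, σ, hu, hv, hσ⟩
    · -- right strip: `σ` left → right in `A`, the `S`-crossing bottom → top
      obtain ⟨u', v', τ, hu', hv', hτ⟩ := hR
      obtain ⟨z, hzσ, hzτ⟩ := Literature.Probability.Percolation.exists_mem_support_of_crossing
        (L := c 0 + 12 * k) (R := c 0 + 36 * k) (B := c 1 - 36 * k) (T := c 1 + 17 * k) σ τ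
        (fun z hz => (hσ z hz).2) (fun z hz => (hτ z hz).2) hu hv hu' hv'
      exact disj z (hτ z hzτ).1 (hσ z hzσ).1
    · -- bottom strip: the `S`-crossing left → right, `σ` bottom → top in `A`
      obtain ⟨u', v', τ, hu', hv', hτ⟩ := hB
      obtain ⟨z, hzτ, hzσ⟩ := Literature.Probability.Percolation.exists_mem_support_of_crossing
        (L := c 0 - 36 * k) (R := c 0 + 36 * k) (B := c 1 - 36 * k) (T := c 1 - 12 * k) τ σ
        (fun z hz => (hτ z hz).2) (fun z hz => (hσ z hz).2) hu' hv' hu hv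
      exact disj z (hτ z hzτ).1 (hσ z hzσ).1
    · -- left strip: `σ` left → right in `A`, the `S`-crossing bottom → top
      obtain ⟨u', v', τ, hu', hv', hτ⟩ := hL
      obtain ⟨z, hzσ, hzτ⟩ := Literature.Probability.Percolation.exists_mem_support_of_crossing
        (L := c 0 - 36 * k) (R := c 0 - 12 * k) (B := c 1 - 36 * k) (T := c 1 + 17 * k) σ τ
        (fun z hz => (hσ z hz).2) (fun z hz => (hτ z hz).2) hu hv hu' hv'
      exact disj z (hτ z hzτ).1 (hσ z hzσ).1
  -- (IV): comparison with the killed hitting probability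
  have hIV := harmExt_hit_le_hitProb Gr S A Θ W hΘ hWfin hSΘ hSW hSA hadj x
  rw [hI, sub_zero] at hIII
  calc circNccwConst ≤ chainM (circNccwU c k) (circNccwL c k) 7 7 x := hII
    _ ≤ F x := hIII
    _ ≤ hitProb Gr Θ A x := hIV

/-- **Shield core, design NE-cw.** See the module docstring. [cite: Chelkak2016, Lemma 2.14] -/
theorem shieldCore_NEcw :
    ∀ (Gr : SimpleGraph (Site 2)) (Θ A S : Set (Site 2)) (c : Site 2) (k : ℕ), 5 ≤ k → Θ.Finite →
      Disjoint S A → S ⊆ Θ → S ⊆ mW c k →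
      (∀ v ∈ S, ∀ e : SRW.Dir 2, Gr.Adj v (v + SRW.stepVec e)) →
      (∀ v ∈ S, ∀ kk : Fin 4, v + cornerUnit kk ∈ mW c k →
        v + cornerUnit kk ∈ S ∨ v + cornerUnit kk ∈ A ∨
          (-8 * (k : ℤ) ≤ (v + cornerUnit kk) 0 - c 0 ∧ (v + cornerUnit kk) 0 - c 0 ≤ -4 * k ∧
              -8 * (k : ℤ) ≤ (v + cornerUnit kk) 1 - c 1 ∧ (v + cornerUnit kk) 1 - c 1 ≤ -4 * k) ∨
          (-2 ≤ (v + cornerUnit kk) 0 - c 0 + 6 * k ∧ -2 ≤ (v + cornerUnit kk) 1 - c 1 + 6 * k ∧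
              7 * ((v + cornerUnit kk) 0 - c 0 + 6 * k) - 17 * ((v + cornerUnit kk) 1 - c 1 + 6 * k) ≤ 23 ∧
              7 * ((v + cornerUnit kk) 1 - c 1 + 6 * k) - 17 * ((v + cornerUnit kk) 0 - c 0 + 6 * k) ≤ 23)) →
      ((∃ (u v : Site 2) (σ : (zdGraph 2).Walk u v), u 0 = c 0 + 12 * k ∧ v 0 = c 0 + 36 * k ∧
          ∀ z ∈ σ.support, z ∈ A ∧ c 0 + 12 * k ≤ z 0 ∧ z 0 ≤ c 0 + 36 * k ∧ c 1 - 36 * k ≤ z 1 ∧ z 1 ≤ c 1 - 9 * k) ∨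
       (∃ (u v : Site 2) (σ : (zdGraph 2).Walk u v), u 1 = c 1 - 36 * k ∧ v 1 = c 1 - 12 * k ∧
          ∀ z ∈ σ.support, z ∈ A ∧ c 0 - 36 * k ≤ z 0 ∧ z 0 ≤ c 0 + 36 * k ∧ c 1 - 36 * k ≤ z 1 ∧ z 1 ≤ c 1 - 12 * k) ∨
       (∃ (u v : Site 2) (σ : (zdGraph 2).Walk u v), u 0 = c 0 - 36 * k ∧ v 0 = c 0 - 12 * k ∧
          ∀ z ∈ σ.support, z ∈ A ∧ c 0 - 36 * k ≤ z 0 ∧ z 0 ≤ c 0 - 12 * k ∧ c 1 - 36 * k ≤ z 1 ∧ z 1 ≤ c 1 + 36 * k) ∨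
       (∃ (u v : Site 2) (σ : (zdGraph 2).Walk u v), u 1 = c 1 + 12 * k ∧ v 1 = c 1 + 36 * k ∧
          ∀ z ∈ σ.support, z ∈ A ∧ c 0 - 36 * k ≤ z 0 ∧ z 0 ≤ c 0 - 9 * k ∧ c 1 + 12 * k ≤ z 1 ∧ z 1 ≤ c 1 + 36 * k)) →
      ∀ x ∈ S, 20 * (k : ℤ) ≤ x 0 - c 0 → x 0 - c 0 ≤ 28 * k → -9 * (k : ℤ) ≤ x 1 - c 1 → x 1 - c 1 ≤ -1 * k →
        circNEcwConst ≤ hitProb Gr Θ A x := by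
  intro Gr Θ A S c k hk hΘ hSA hSΘ hSW hadj hcl hA x hxS hx0 hx0' hx1 hx1'
  have hk0 : 0 < k := by omega
  set W := mW c k with hW
  have hWfin : W.Finite := mW_finite c k
  set F : Site 2 → ℝ := harmExt (S ∩ W) (fun w => if w ∈ A then (1 : ℝ) else 0) with hF
  -- the start point lies in the first start set
  have hxT : x ∈ circNEcwT c k 0 := circNEcw_start c k hk0 x hx0 hx0' hx1 hx1'
  -- (III-A): the refined chain inequality
  have hkey : ∀ i, ∀ v ∈ circNEcwU c k i ∩ S, ∀ kk : Fin 4,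
      v + cornerUnit kk ∈ S ∨ v + cornerUnit kk ∈ A ∨
        (v + cornerUnit kk ∉ circNEcwU c k i ∧ v + cornerUnit kk ∉ circNEcwL c k i) := by
    intro i v hv kk
    by_cases hw : v + cornerUnit kk ∈ circNEcwU c k i ∪ circNEcwL c k i
    · have hwW : v + cornerUnit kk ∈ mW c k := by
        rcases hw with h | h
        · exact circNEcwU_subset_mW c k i h
        · exact circNEcwL_subset_mW c k hk0 i h
      rcases hcl v hv.2 kk hwW with h | h | h | h
      · exact Or.inl h
      · exact Or.inr (Or.inl h)
      · exfalso
        have hav := (circNEcw_avoids c k hk i _ hw).1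
        rcases hav with h' | h' | h' | h' <;> omega
      · exfalso
        have hav := (circNEcw_avoids c k hk i _ hw).2
        rcases hav with h' | h' | h' | h' <;> omega
    · rw [Set.mem_union, not_or] at hw
      exact Or.inr (Or.inr hw)
  have hIII := chainM_sub_chainN_le_harmExt_hit (circNEcwU c k) (circNEcwL c k) S A W 10 (circNEcwU_finite c k) hWfin
    (circNEcwU_subset_mW c k) (circNEcwL_subset_mW c k hk0) (disjoint_circNEcwU_L c k) hSA hkey 10 x hxS
  -- (II): the free chain
  have hII := circNEcwConst_le_chainM c k hk0 x hxT
  -- (I-A): the killed chain vanishes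
  have hI : chainN (circNEcwU c k) (circNEcwL c k) S 10 10 x = 0 := by
    by_contra hne
    have hpos : 0 < chainN (circNEcwU c k) (circNEcwL c k) S 10 10 x :=
      lt_of_le_of_ne (chainN_mem_Icc (circNEcwU_finite c k) 10 x).1 (Ne.symm hne)
    obtain ⟨hR, hB, hL, hT⟩ := circNEcw_crossings_of_chainN_pos c k hk0 x hxT hxS (by omega) hpos
    have disj : ∀ z, z ∈ S → z ∈ A → False := fun z hzS hzA => hSA.le_bot ⟨hzS, hzA⟩
    rcases hA with ⟨u, v, σ, hu, hv, hσ⟩ | ⟨u, v, σ, hu, hv, hσ⟩ | ⟨u, v, σ, hu, hv, hσ⟩ | ⟨u, v, σ, hu, hv, hσ⟩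
    · -- right strip (below the slit): `σ` left → right in `A`, the `S`-crossing bottom → top
      obtain ⟨u', v', τ, hu', hv', hτ⟩ := hR
      obtain ⟨z, hzσ, hzτ⟩ := Literature.Probability.Percolation.exists_mem_support_of_crossing
        (L := c 0 + 12 * k) (R := c 0 + 36 * k) (B := c 1 - 36 * k) (T := c 1 - 9 * k) σ τ
        (fun z hz => (hσ z hz).2) (fun z hz => (hτ z hz).2) hu hv hu' hv'
      exact disj z (hτ z hzτ).1 (hσ z hzσ).1
    · -- bottom strip: the `S`-crossing left → right, `σ` bottom → top in `A`
      obtain ⟨u', v', τ, hu', hv', hτ⟩ := hB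
      obtain ⟨z, hzτ, hzσ⟩ := Literature.Probability.Percolation.exists_mem_support_of_crossing
        (L := c 0 - 36 * k) (R := c 0 + 36 * k) (B := c 1 - 36 * k) (T := c 1 - 12 * k) τ σ
        (fun z hz => (hτ z hz).2) (fun z hz => (hσ z hz).2) hu' hv' hu hv
      exact disj z (hτ z hzτ).1 (hσ z hzσ).1
    · -- left strip (full): `σ` left → right in `A`, the `S`-crossing bottom → top
      obtain ⟨u', v', τ, hu', hv', hτ⟩ := hL
      obtain ⟨z, hzσ, hzτ⟩ := Literature.Probability.Percolation.exists_mem_support_of_crossing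
        (L := c 0 - 36 * k) (R := c 0 - 12 * k) (B := c 1 - 36 * k) (T := c 1 + 36 * k) σ τ
        (fun z hz => (hσ z hz).2) (fun z hz => (hτ z hz).2) hu hv hu' hv'
      exact disj z (hτ z hzτ).1 (hσ z hzσ).1
    · -- top strip (left of the slit): the `S`-crossing left → right, `σ` bottom → top in `A`
      obtain ⟨u', v', τ, hu', hv', hτ⟩ := hT
      obtain ⟨z, hzτ, hzσ⟩ := Literature.Probability.Percolation.exists_mem_support_of_crossing
        (L := c 0 - 36 * k) (R := c 0 - 9 * k) (B := c 1 + 12 * k) (T := c 1 + 36 * k) τ σ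
        (fun z hz => (hτ z hz).2) (fun z hz => (hσ z hz).2) hu' hv' hu hv
      exact disj z (hτ z hzτ).1 (hσ z hzσ).1
  -- (IV): comparison with the killed hitting probability
  have hIV := harmExt_hit_le_hitProb Gr S A Θ W hΘ hWfin hSΘ hSW hSA hadj x
  rw [hI, sub_zero] at hIII
  calc circNEcwConst ≤ chainM (circNEcwU c k) (circNEcwL c k) 10 10 x := hII
    _ ≤ F x := hIII
    _ ≤ hitProb Gr Θ A x := hIV

/-- **Shield core, design NE-ccw.** See the module docstring. [cite: Chelkak2016, Lemma 2.14] -/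
theorem shieldCore_NEccw :
    ∀ (Gr : SimpleGraph (Site 2)) (Θ A S : Set (Site 2)) (c : Site 2) (k : ℕ), 5 ≤ k → Θ.Finite →
      Disjoint S A → S ⊆ Θ → S ⊆ mW c k →
      (∀ v ∈ S, ∀ e : SRW.Dir 2, Gr.Adj v (v + SRW.stepVec e)) →
      (∀ v ∈ S, ∀ kk : Fin 4, v + cornerUnit kk ∈ mW c k →
        v + cornerUnit kk ∈ S ∨ v + cornerUnit kk ∈ A ∨
          (-8 * (k : ℤ) ≤ (v + cornerUnit kk) 0 - c 0 ∧ (v + cornerUnit kk) 0 - c 0 ≤ -4 * k ∧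
              -8 * (k : ℤ) ≤ (v + cornerUnit kk) 1 - c 1 ∧ (v + cornerUnit kk) 1 - c 1 ≤ -4 * k) ∨
          (-2 ≤ (v + cornerUnit kk) 0 - c 0 + 6 * k ∧ -2 ≤ (v + cornerUnit kk) 1 - c 1 + 6 * k ∧
              7 * ((v + cornerUnit kk) 0 - c 0 + 6 * k) - 17 * ((v + cornerUnit kk) 1 - c 1 + 6 * k) ≤ 23 ∧
              7 * ((v + cornerUnit kk) 1 - c 1 + 6 * k) - 17 * ((v + cornerUnit kk) 0 - c 0 + 6 * k) ≤ 23)) →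
      ((∃ (u v : Site 2) (σ : (zdGraph 2).Walk u v), u 0 = c 0 + 12 * k ∧ v 0 = c 0 + 36 * k ∧
          ∀ z ∈ σ.support, z ∈ A ∧ c 0 + 12 * k ≤ z 0 ∧ z 0 ≤ c 0 + 36 * k ∧ c 1 - 36 * k ≤ z 1 ∧ z 1 ≤ c 1 - 9 * k) ∨
       (∃ (u v : Site 2) (σ : (zdGraph 2).Walk u v), u 1 = c 1 - 36 * k ∧ v 1 = c 1 - 12 * k ∧
          ∀ z ∈ σ.support, z ∈ A ∧ c 0 - 36 * k ≤ z 0 ∧ z 0 ≤ c 0 + 36 * k ∧ c 1 - 36 * k ≤ z 1 ∧ z 1 ≤ c 1 - 12 * k) ∨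
       (∃ (u v : Site 2) (σ : (zdGraph 2).Walk u v), u 0 = c 0 - 36 * k ∧ v 0 = c 0 - 12 * k ∧
          ∀ z ∈ σ.support, z ∈ A ∧ c 0 - 36 * k ≤ z 0 ∧ z 0 ≤ c 0 - 12 * k ∧ c 1 - 36 * k ≤ z 1 ∧ z 1 ≤ c 1 + 36 * k) ∨
       (∃ (u v : Site 2) (σ : (zdGraph 2).Walk u v), u 1 = c 1 + 12 * k ∧ v 1 = c 1 + 36 * k ∧
          ∀ z ∈ σ.support, z ∈ A ∧ c 0 - 36 * k ≤ z 0 ∧ z 0 ≤ c 0 - 9 * k ∧ c 1 + 12 * k ≤ z 1 ∧ z 1 ≤ c 1 + 36 * k)) →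
      ∀ x ∈ S, -9 * (k : ℤ) ≤ x 0 - c 0 → x 0 - c 0 ≤ -1 * k → 20 * (k : ℤ) ≤ x 1 - c 1 → x 1 - c 1 ≤ 28 * k →
        circNEccwConst ≤ hitProb Gr Θ A x := by
  intro Gr Θ A S c k hk hΘ hSA hSΘ hSW hadj hcl hA x hxS hx0 hx0' hx1 hx1'
  have hk0 : 0 < k := by omega
  set W := mW c k with hW
  have hWfin : W.Finite := mW_finite c k
  set F : Site 2 → ℝ := harmExt (S ∩ W) (fun w => if w ∈ A then (1 : ℝ) else 0) with hF
  -- the start point lies in the first start set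
  have hxT : x ∈ circNEccwT c k 0 := circNEccw_start c k hk0 x hx0 hx0' hx1 hx1'
  -- (III-A): the refined chain inequality
  have hkey : ∀ i, ∀ v ∈ circNEccwU c k i ∩ S, ∀ kk : Fin 4,
      v + cornerUnit kk ∈ S ∨ v + cornerUnit kk ∈ A ∨
        (v + cornerUnit kk ∉ circNEccwU c k i ∧ v + cornerUnit kk ∉ circNEccwL c k i) := by
    intro i v hv kk
    by_cases hw : v + cornerUnit kk ∈ circNEccwU c k i ∪ circNEccwL c k i
    · have hwW : v + cornerUnit kk ∈ mW c k := by
        rcases hw with h | h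
        · exact circNEccwU_subset_mW c k i h
        · exact circNEccwL_subset_mW c k hk0 i h
      rcases hcl v hv.2 kk hwW with h | h | h | h
      · exact Or.inl h
      · exact Or.inr (Or.inl h)
      · exfalso
        have hav := (circNEccw_avoids c k hk i _ hw).1
        rcases hav with h' | h' | h' | h' <;> omega
      · exfalso
        have hav := (circNEccw_avoids c k hk i _ hw).2
        rcases hav with h' | h' | h' | h' <;> omega
    · rw [Set.mem_union, not_or] at hw
      exact Or.inr (Or.inr hw)
  have hIII := chainM_sub_chainN_le_harmExt_hit (circNEccwU c k) (circNEccwL c k) S A W 10 (circNEccwU_finite c k) hWfin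
    (circNEccwU_subset_mW c k) (circNEccwL_subset_mW c k hk0) (disjoint_circNEccwU_L c k) hSA hkey 10 x hxS
  -- (II): the free chain
  have hII := circNEccwConst_le_chainM c k hk0 x hxT
  -- (I-A): the killed chain vanishes
  have hI : chainN (circNEccwU c k) (circNEccwL c k) S 10 10 x = 0 := by
    by_contra hne
    have hpos : 0 < chainN (circNEccwU c k) (circNEccwL c k) S 10 10 x :=
      lt_of_le_of_ne (chainN_mem_Icc (circNEccwU_finite c k) 10 x).1 (Ne.symm hne)
    obtain ⟨hT, hL, hB, hR⟩ := circNEccw_crossings_of_chainN_pos c k hk0 x hxT hxS (by omega) hpos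
    have disj : ∀ z, z ∈ S → z ∈ A → False := fun z hzS hzA => hSA.le_bot ⟨hzS, hzA⟩
    rcases hA with ⟨u, v, σ, hu, hv, hσ⟩ | ⟨u, v, σ, hu, hv, hσ⟩ | ⟨u, v, σ, hu, hv, hσ⟩ | ⟨u, v, σ, hu, hv, hσ⟩
    · -- right strip (below the slit): `σ` left → right in `A`, the `S`-crossing bottom → top
      obtain ⟨u', v', τ, hu', hv', hτ⟩ := hR
      obtain ⟨z, hzσ, hzτ⟩ := Literature.Probability.Percolation.exists_mem_support_of_crossing
        (L := c 0 + 12 * k) (R := c 0 + 36 * k) (B := c 1 - 36 * k) (T := c 1 - 9 * k) σ τ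
        (fun z hz => (hσ z hz).2) (fun z hz => (hτ z hz).2) hu hv hu' hv'
      exact disj z (hτ z hzτ).1 (hσ z hzσ).1
    · -- bottom strip: the `S`-crossing left → right, `σ` bottom → top in `A`
      obtain ⟨u', v', τ, hu', hv', hτ⟩ := hB
      obtain ⟨z, hzτ, hzσ⟩ := Literature.Probability.Percolation.exists_mem_support_of_crossing
        (L := c 0 - 36 * k) (R := c 0 + 36 * k) (B := c 1 - 36 * k) (T := c 1 - 12 * k) τ σ
        (fun z hz => (hτ z hz).2) (fun z hz => (hσ z hz).2) hu' hv' hu hv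
      exact disj z (hτ z hzτ).1 (hσ z hzσ).1
    · -- left strip (full): `σ` left → right in `A`, the `S`-crossing bottom → top
      obtain ⟨u', v', τ, hu', hv', hτ⟩ := hL
      obtain ⟨z, hzσ, hzτ⟩ := Literature.Probability.Percolation.exists_mem_support_of_crossing
        (L := c 0 - 36 * k) (R := c 0 - 12 * k) (B := c 1 - 36 * k) (T := c 1 + 36 * k) σ τ
        (fun z hz => (hσ z hz).2) (fun z hz => (hτ z hz).2) hu hv hu' hv'
      exact disj z (hτ z hzτ).1 (hσ z hzσ).1
    · -- top strip (left of the slit): the `S`-crossing left → right, `σ` bottom → top in `A`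
      obtain ⟨u', v', τ, hu', hv', hτ⟩ := hT
      obtain ⟨z, hzτ, hzσ⟩ := Literature.Probability.Percolation.exists_mem_support_of_crossing
        (L := c 0 - 36 * k) (R := c 0 - 9 * k) (B := c 1 + 12 * k) (T := c 1 + 36 * k) τ σ
        (fun z hz => (hτ z hz).2) (fun z hz => (hσ z hz).2) hu' hv' hu hv
      exact disj z (hτ z hzτ).1 (hσ z hzσ).1
  -- (IV): comparison with the killed hitting probability
  have hIV := harmExt_hit_le_hitProb Gr S A Θ W hΘ hWfin hSΘ hSW hSA hadj x
  rw [hI, sub_zero] at hIII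
  calc circNEccwConst ≤ chainM (circNEccwU c k) (circNEccwL c k) 10 10 x := hII
    _ ≤ F x := hIII
    _ ≤ hitProb Gr Θ A x := hIV

end Summit.CriticalPhenomena.SAWScalingLimit.Theorems.AvoidanceLimit.Anchor

end
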